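import Summits.QuantumFields.YangMills.Theorems.FluctuationComparisonRegPrIntLS2BetaCoarseCurlKernelCount
import Summits.QuantumFields.YangMills.Theorems.FluctuationComparisonRegPrIntLS2BetaReadNesting
import HarnessLib

/-!
# S2β · (SCT′-c)₁ — «THE COMPOSED DILUTION KERNEL» on Bałaban's torus tower (generic `P : Params`, one plaquette orientation): the `r`-fold composition of CURL-AVG's one-step
# diluted-Stokes kernel EXISTS with entries in `[0, m^r]` (`m = (d!)²L²∕|I| = L^{2−d}`), column sums `≤ m^r`, row sums `= (L²)^r`, support within `2` sites of `T^{(r)}` of the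
# `r`-block of the fine base point, and it DOMINATES every family obeying the one-step rows — with the sources propagated by the row sums

Cell `ym3-torus` (YM ladder rung R3 = continuum `SU(2)` Yang–Mills on the three-torus at fixed lattice data — a RUNG: NOT d = 4, NOT infinite volume, NOT a mass gap,
NOT Clay).  Width seat «width 16» `ym3-torus-px16` (gen 23), S2β pairing-letter lane holder by lineage; crux `stmt-QuantumFields-20520`
(`…Theses.UnitScaleTilt.FluctuationComparisonRegPrIntL`), LINE g18-1 S2β.  `--kind proof --supports stmt-QuantumFields-20520 --as helper`, count-neutral, DEFINITION-FREE
(0 `def`, 0 `instance`, 0 `notation`, 0 `sorry`, default heartbeats); the composed kernel is packaged by `∃` and built inside the proof.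

WHY (px16 g22 17:49:04Z LOCATE (i) «propagate with the TRUE kernel»; px13 g26 CURL-AVG B2 ✓p830155 ∕ C ✓p830200 ∕ E ✓p830658 ∕ F ✓p830710; the lattice-free dock ✓`…ComposedKernelDock`).
CURL-AVG's one-step row for the sizes `ρ_{j+1}(y)` of the coarse relative curls of orientation `(μ, ν)` reads
    `ρ_{j+1}(y) ≤ |I|⁻¹·Σ_{(i,s,t) ∈ I × [0,L)²} ρ_j(x_i + s e_μ + t e_ν) + src_{j+1}(y)`,   `x_i = blockSite y r_i`
(B2∕C in the LOWER-LEFT-corner convention for both levels: B2's fine plaquette «lower-right corner `x_i + (s+1)e_μ + t e_ν`, word `[ν⁺, μ̄, ν̄, μ⁺]`» IS the plaquette with lower-left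
corner `x_i + s e_μ + t e_ν` read one edge later — a conjugation, norm-invariant; the one-line conversion is the c₁ knit's).  Iterating `r` times from the finest level `0` gives a kernel
`K_r(y, z)`, `y ∈ T^{(r)}`, `z ∈ T^{(0)}`; the dock ✓`dock_of_kernel` needs exactly: `0 ≤ K_r ≤ m^r` (F (b) per step, composed by ✓`comp_le_max_mul_colsum` with the column sums
F (c)), support in O(1) generation-`r` cells (E (d) per step: the base points block into the four corner blocks; composed with px10 g25 ✓`natAbs_rel_blockOf_le_one`: «within 2 coarse
sites» is STABLE under one more step because `2 ≤ L`), and the domination of the actual sizes by `K_r ρ_0` plus propagated sources (row sums `L²` per step).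

WHAT IS PROVED (sorry-free; `P : Params` generic, `μ ≠ ν`, standing range `r ≤ m + K`).
§1 COUNTING in the lower-left convention (px13 F's two injections, re-read without the `+1`): ★`card_filter_baseLL_eq_le` (one coarse plaquette: each fine base point is hit by at most
   `(d!)²·L²` of the `|I|·L²` index triples), ★`card_filter_baseLL_eq_le_all` (all coarse plaquettes together: the same bound — column sums); ★`card_triples`; the two
   FIBERWISE corollaries ★`sum_baseLL_le` ∕ ★`sum_sum_baseLL_le` (`Σ f(base) ≤ (d!)²L²·Σ_z f z` for `f ≥ 0`, one plaquette ∕ all plaquettes); ★`mLL_eq`.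
§2 GEOMETRY: ★`natAbs_rel_blockOf_baseLL_le_one` (the base point blocks to within ONE site of `y` in every coordinate — E ✓`blockOf_shiftN_shiftN_blockSite` + lit
   ✓`rel_shift_of_le`), ★`natAbs_rel_blockOf_le_two_of_baseLL` (the STABILITY step: within `2` of `T^{(r)}` under a base point of `y` ⟹ within `2` of `T^{(r+1)}` under `y`),
   ★`exists_blockIter_eq` (`blockIter r` is onto).
§3 ★★★`exists_composedKernel` — for every `r ≤ m + K` there is `K : Site P r → Site P 0 → ℝ` with
   (K0) `0 ≤ K y z`; (K1) `K y z ≤ m^r`; (K2) `Σ_y K y z ≤ m^r`; (K3) `Σ_z K y z = (L²)^r`; (K4) `K y z ≠ 0 → ∀ κ, |rel y (blockIter r z)|_κ ≤ 2`;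
   (K5) DOMINATION WITH SOURCES: for all families `ρ src : (i : ℕ) → Site P i → ℝ` obeying the rows `ρ_{i+1}(y′) ≤ |I|⁻¹Σ_a ρ_i(base a y′) + src_{i+1}(y′)` (`i < r`), every `y`, and
   every `σ : ℕ → ℝ` bounding the sources on the region under `y` (`∀ 1 ≤ i ≤ r, ∀ x, (∀ κ, |rel y (blockIter r x)|_κ ≤ 2) → src_i(blockIter i x) ≤ σ_i`):
        `ρ_r(y) ≤ Σ_z K y z·ρ_0(z) + Σ_{i=1}^{r} (L²)^{r−i}·σ_i`,
   where `m := (d!)²·L²∕|I|` (★`mLL_eq`: `= L²∕L^d`, i.e. `L^{2−d}`).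
WHAT IS NOT HERE: the identification of `ρ_i` with the descended pair's relative curls (CURL-AVG C∕D∕E local editions, the `descendTo`∕`bondShift` casts of FILE 3′ ✓∕⧗`…SupTowerOfLiftLadderNested`),
the class maps `cl n` ∕ representatives `embIter` feeding ✓`dock_of_kernel`, the θ-source budget ((M,V) profile) — the c₁ KNIT, next.

HONEST SCOPE.  Finite torus combinatorics; nothing of Bałaban's analysis is asserted or proved ([Balaban1985Averaging] (19)–(20) p.21, Prop. 1 (51) p.26: the printed one-step
average of plaquette variables whose kernel this composes; [Balaban1987RG1] (0.1)–(0.4) pp.251–253: the torus tower); (SCT′-c)₁₂₃, (LIFT-LAD′), (TOP-LAD′), (ST′), (ST), LOC,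
AVG₂♭-ax_q, (D-ax), h3 HYPOTHESES; GAP♯∘ (`stub_uniformFibreGapOrbit`, registry untouched, 0∕5), S2β, crux 20520, 19936, 19200 and `YM3TorusSU2` are NOT proved; no registered
stub is closed; rung R3 = SU(2) YM₃ on T³ — NOT d = 4, NOT infinite volume, NOT a mass gap, NOT Clay; the Yang–Mills mass gap is NOT proved.
References: T. Bałaban, CMP **98** (1985) 17–51 [Balaban1985Averaging]; CMP **109** (1987) 249–301 [Balaban1987RG1].
-/

set_option autoImplicit false

noncomputable section

namespace Summit.QuantumFields.YangMills.Theorems.FluctuationComparisonRegPrIntLS2BetaComposedDilutionKernel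

open scoped BigOperators
open Finset
open Literature.MathematicalPhysics.QuantumFieldTheory.Balaban1983to89
open Literature.MathematicalPhysics.QuantumFieldTheory.Balaban1983to89.T4Continuum
open Literature.MathematicalPhysics.QuantumFieldTheory.Balaban1983to89.BlockAveraging (Idx)
open Literature.MathematicalPhysics.QuantumFieldTheory.Balaban1983to89.B10Eq47AxialChi (shiftN shiftN_succ shiftN_zero)
open Literature.MathematicalPhysics.QuantumFieldTheory.Balaban1983to89.AveragingRT (blockSite_inj)
open B10Eq27TorusAxialLog (rel rel_apply rel_self rel_shift_of_le)
open B14.Eq22Determines (blockIter blockIter_zero blockIter_succ)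
open Summit.QuantumFields.YangMills.Theorems.FluctuationComparisonRegPrIntLS2BetaCoarseCurlKernelCount (shiftN_left_injective)
open Summit.QuantumFields.YangMills.Theorems.FluctuationComparisonRegPrIntLS2BetaCoarseCurlLocal (blockOf_shiftN_shiftN_blockSite)
open Summit.QuantumFields.YangMills.Theorems.FluctuationComparisonRegPrIntLS2BetaReadNesting (natAbs_rel_le_add natAbs_rel_blockOf_le_one)

variable {P : Params}

/-! ## §1 Counting in the lower-left convention -/

section Counting

/-- ★ **ONE COARSE PLAQUETTE (lower-left convention): EACH FINE BASE POINT IS HIT AT MOST `(d!)²·L²` TIMES** among the `|I|·L²` triples `(i, s, t)`, `x_i + s e_μ + t e_ν = z`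
(px13 F ✓`card_filter_base_eq_le` without the `+1`: for fixed `(σ, σ′, s, t)` the offset `r` is determined). [cite: Balaban1987RG1, (0.1)-(0.3) p.252; Balaban1985Averaging, Prop. 1 (51) p.26] -/
theorem card_filter_baseLL_eq_le {j : ℕ} (hj : j + 1 ≤ P.m + P.K) (y : Site P (j + 1)) (μ ν : Fin P.d) (z : Site P j) :
    (((Finset.univ : Finset (Idx P)) ×ˢ (Finset.range P.L ×ˢ Finset.range P.L)).filter
        (fun a => shiftN (shiftN (Site.blockSite y a.1.1) μ a.2.1) ν a.2.2 = z)).card ≤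
      (Fintype.card (Equiv.Perm (Fin P.d))) ^ 2 * P.L ^ 2 := by
  classical
  set S := ((Finset.univ : Finset (Idx P)) ×ˢ (Finset.range P.L ×ˢ Finset.range P.L)).filter
        (fun a => shiftN (shiftN (Site.blockSite y a.1.1) μ a.2.1) ν a.2.2 = z) with hS
  set T : Finset ((Equiv.Perm (Fin P.d) × Equiv.Perm (Fin P.d)) × (ℕ × ℕ)) := (Finset.univ ×ˢ Finset.univ) ×ˢ (Finset.range P.L ×ˢ Finset.range P.L) with hT
  have hcardT : T.card = (Fintype.card (Equiv.Perm (Fin P.d))) ^ 2 * P.L ^ 2 := by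
    rw [hT, Finset.card_product, Finset.card_product, Finset.card_product, Finset.card_univ, Finset.card_range]; ring
  rw [← hcardT]
  refine Finset.card_le_card_of_injOn (fun a => ((a.1.2.1, a.1.2.2), a.2)) (fun a ha => ?_) (fun a ha a' ha' h => ?_)
  · rw [hS, Finset.mem_coe, Finset.mem_filter, Finset.mem_product] at ha
    rw [hT, Finset.mem_coe, Finset.mem_product, Finset.mem_product]
    exact ⟨⟨Finset.mem_univ _, Finset.mem_univ _⟩, ha.1.2⟩
  · rw [hS, Finset.mem_coe, Finset.mem_filter] at ha ha'
    simp only [Prod.mk.injEq] at h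
    obtain ⟨⟨hσ, hσ'⟩, hst⟩ := h
    have hbase : shiftN (shiftN (Site.blockSite y a.1.1) μ a.2.1) ν a.2.2 = shiftN (shiftN (Site.blockSite y a'.1.1) μ a'.2.1) ν a'.2.2 := by
      rw [ha.2, ha'.2]
    rw [hst] at hbase
    have hr : a.1.1 = a'.1.1 := (blockSite_inj hj (shiftN_left_injective μ _ (shiftN_left_injective ν _ hbase))).2
    exact Prod.ext (Prod.ext hr (Prod.ext hσ hσ')) hst

/-- ★ **ALL COARSE PLAQUETTES OF THE ORIENTATION TOGETHER (lower-left convention): EACH FINE BASE POINT IS HIT AT MOST `(d!)²·L²` TIMES** among the quadruples `(y, (i, s, t))`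
— the column-sum count (`(y, r) ↦ blockSite y r` jointly injective). [cite: Balaban1987RG1, (0.1)-(0.3) p.252; Balaban1985Averaging, Prop. 1 (51) p.26] -/
theorem card_filter_baseLL_eq_le_all {j : ℕ} (hj : j + 1 ≤ P.m + P.K) (μ ν : Fin P.d) (z : Site P j) :
    (((Finset.univ : Finset (Site P (j + 1))) ×ˢ ((Finset.univ : Finset (Idx P)) ×ˢ (Finset.range P.L ×ˢ Finset.range P.L))).filter
        (fun b => shiftN (shiftN (Site.blockSite b.1 b.2.1.1) μ b.2.2.1) ν b.2.2.2 = z)).card ≤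
      (Fintype.card (Equiv.Perm (Fin P.d))) ^ 2 * P.L ^ 2 := by
  classical
  set S := (((Finset.univ : Finset (Site P (j + 1))) ×ˢ ((Finset.univ : Finset (Idx P)) ×ˢ (Finset.range P.L ×ˢ Finset.range P.L))).filter
        (fun b => shiftN (shiftN (Site.blockSite b.1 b.2.1.1) μ b.2.2.1) ν b.2.2.2 = z)) with hS
  set T : Finset ((Equiv.Perm (Fin P.d) × Equiv.Perm (Fin P.d)) × (ℕ × ℕ)) := (Finset.univ ×ˢ Finset.univ) ×ˢ (Finset.range P.L ×ˢ Finset.range P.L) with hT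
  have hcardT : T.card = (Fintype.card (Equiv.Perm (Fin P.d))) ^ 2 * P.L ^ 2 := by
    rw [hT, Finset.card_product, Finset.card_product, Finset.card_product, Finset.card_univ, Finset.card_range]; ring
  rw [← hcardT]
  refine Finset.card_le_card_of_injOn (fun b => ((b.2.1.2.1, b.2.1.2.2), b.2.2)) (fun b hb => ?_) (fun b hb b' hb' h => ?_)
  · rw [hS, Finset.mem_coe, Finset.mem_filter, Finset.mem_product, Finset.mem_product] at hb
    rw [hT, Finset.mem_coe, Finset.mem_product, Finset.mem_product]
    exact ⟨⟨Finset.mem_univ _, Finset.mem_univ _⟩, hb.1.2.2⟩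
  · rw [hS, Finset.mem_coe, Finset.mem_filter] at hb hb'
    simp only [Prod.mk.injEq] at h
    obtain ⟨⟨hσ, hσ'⟩, hst⟩ := h
    have hbase : shiftN (shiftN (Site.blockSite b.1 b.2.1.1) μ b.2.2.1) ν b.2.2.2 = shiftN (shiftN (Site.blockSite b'.1 b'.2.1.1) μ b'.2.2.1) ν b'.2.2.2 := by
      rw [hb.2, hb'.2]
    rw [hst] at hbase
    have hyr := blockSite_inj hj (shiftN_left_injective μ _ (shiftN_left_injective ν _ hbase))
    exact Prod.ext hyr.1 (Prod.ext (Prod.ext hyr.2 (Prod.ext hσ hσ')) hst)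

/-- ★ The number of index triples `(i, s, t)`: `|I|·(L·L)`. [folklore] -/
theorem card_triples : (((Finset.univ : Finset (Idx P)) ×ˢ (Finset.range P.L ×ˢ Finset.range P.L))).card = Fintype.card (Idx P) * (P.L * P.L) := by
  rw [Finset.card_product, Finset.card_product, Finset.card_univ, Finset.card_range]

/-- ★ **FIBERWISE, ONE COARSE PLAQUETTE**: `Σ_{(i,s,t)} f(x_i + s e_μ + t e_ν) ≤ (d!)²L²·Σ_z f z` for `f ≥ 0`. [cite: Balaban1985Averaging, Prop. 1 (51) p.26 (bookkeeping)] -/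
theorem sum_baseLL_le {j : ℕ} (hj : j + 1 ≤ P.m + P.K) (y : Site P (j + 1)) (μ ν : Fin P.d) (f : Site P j → ℝ) (hf : ∀ z, 0 ≤ f z) :
    ∑ a ∈ (Finset.univ : Finset (Idx P)) ×ˢ (Finset.range P.L ×ˢ Finset.range P.L), f (shiftN (shiftN (Site.blockSite y a.1.1) μ a.2.1) ν a.2.2) ≤
      (((Fintype.card (Equiv.Perm (Fin P.d))) ^ 2 * P.L ^ 2 : ℕ) : ℝ) * ∑ z, f z := by
  classical
  set A := (Finset.univ : Finset (Idx P)) ×ˢ (Finset.range P.L ×ˢ Finset.range P.L) with hA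
  have hC : (0 : ℝ) ≤ (((Fintype.card (Equiv.Perm (Fin P.d))) ^ 2 * P.L ^ 2 : ℕ) : ℝ) := Nat.cast_nonneg _
  rw [Finset.sum_comp f (fun a : Idx P × (ℕ × ℕ) => shiftN (shiftN (Site.blockSite y a.1.1) μ a.2.1) ν a.2.2)]
  calc ∑ b ∈ A.image (fun a : Idx P × (ℕ × ℕ) => shiftN (shiftN (Site.blockSite y a.1.1) μ a.2.1) ν a.2.2),
        (A.filter (fun a => shiftN (shiftN (Site.blockSite y a.1.1) μ a.2.1) ν a.2.2 = b)).card • f b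
      ≤ ∑ b ∈ A.image (fun a : Idx P × (ℕ × ℕ) => shiftN (shiftN (Site.blockSite y a.1.1) μ a.2.1) ν a.2.2),
        (((Fintype.card (Equiv.Perm (Fin P.d))) ^ 2 * P.L ^ 2 : ℕ) : ℝ) * f b := by
          refine Finset.sum_le_sum fun b _ => ?_
          rw [nsmul_eq_mul]
          refine mul_le_mul_of_nonneg_right ?_ (hf b)
          exact_mod_cast card_filter_baseLL_eq_le hj y μ ν b
    _ ≤ ∑ b, (((Fintype.card (Equiv.Perm (Fin P.d))) ^ 2 * P.L ^ 2 : ℕ) : ℝ) * f b :=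
          Finset.sum_le_sum_of_subset_of_nonneg (Finset.subset_univ _) fun b _ _ => mul_nonneg hC (hf b)
    _ = _ := by rw [Finset.mul_sum]

/-- ★ **FIBERWISE, ALL COARSE PLAQUETTES**: `Σ_y Σ_{(i,s,t)} f(x_i(y) + s e_μ + t e_ν) ≤ (d!)²L²·Σ_z f z` for `f ≥ 0` (column sums). [cite: Balaban1985Averaging, Prop. 1 (51) p.26 (bookkeeping)] -/
theorem sum_sum_baseLL_le {j : ℕ} (hj : j + 1 ≤ P.m + P.K) (μ ν : Fin P.d) (f : Site P j → ℝ) (hf : ∀ z, 0 ≤ f z) :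
    ∑ y : Site P (j + 1), ∑ a ∈ (Finset.univ : Finset (Idx P)) ×ˢ (Finset.range P.L ×ˢ Finset.range P.L), f (shiftN (shiftN (Site.blockSite y a.1.1) μ a.2.1) ν a.2.2) ≤
      (((Fintype.card (Equiv.Perm (Fin P.d))) ^ 2 * P.L ^ 2 : ℕ) : ℝ) * ∑ z, f z := by
  classical
  set A := (Finset.univ : Finset (Idx P)) ×ˢ (Finset.range P.L ×ˢ Finset.range P.L) with hA
  set B := (Finset.univ : Finset (Site P (j + 1))) ×ˢ A with hB
  have hC : (0 : ℝ) ≤ (((Fintype.card (Equiv.Perm (Fin P.d))) ^ 2 * P.L ^ 2 : ℕ) : ℝ) := Nat.cast_nonneg _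
  have e := Finset.sum_product' (Finset.univ : Finset (Site P (j + 1))) A
    (fun (y : Site P (j + 1)) (a : Idx P × (ℕ × ℕ)) => f (shiftN (shiftN (Site.blockSite y a.1.1) μ a.2.1) ν a.2.2))
  rw [← e, ← hB, Finset.sum_comp f (fun b : Site P (j + 1) × (Idx P × (ℕ × ℕ)) => shiftN (shiftN (Site.blockSite b.1 b.2.1.1) μ b.2.2.1) ν b.2.2.2)]
  calc ∑ w ∈ B.image (fun b : Site P (j + 1) × (Idx P × (ℕ × ℕ)) => shiftN (shiftN (Site.blockSite b.1 b.2.1.1) μ b.2.2.1) ν b.2.2.2),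
        (B.filter (fun b => shiftN (shiftN (Site.blockSite b.1 b.2.1.1) μ b.2.2.1) ν b.2.2.2 = w)).card • f w
      ≤ ∑ w ∈ B.image (fun b : Site P (j + 1) × (Idx P × (ℕ × ℕ)) => shiftN (shiftN (Site.blockSite b.1 b.2.1.1) μ b.2.2.1) ν b.2.2.2),
        (((Fintype.card (Equiv.Perm (Fin P.d))) ^ 2 * P.L ^ 2 : ℕ) : ℝ) * f w := by
          refine Finset.sum_le_sum fun w _ => ?_
          rw [nsmul_eq_mul]
          refine mul_le_mul_of_nonneg_right ?_ (hf w)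
          rw [hB, hA]
          exact_mod_cast card_filter_baseLL_eq_le_all hj μ ν w
    _ ≤ ∑ w, (((Fintype.card (Equiv.Perm (Fin P.d))) ^ 2 * P.L ^ 2 : ℕ) : ℝ) * f w :=
          Finset.sum_le_sum_of_subset_of_nonneg (Finset.subset_univ _) fun w _ _ => mul_nonneg hC (hf w)
    _ = _ := by rw [Finset.mul_sum]

/-- ★ The dilution constant in closed form: `m = (d!)²·L²∕|I| = L²∕L^d` (`|I| = L^d·(d!)²`, lit ✓`card_idx`). [cite: Balaban1987RG1, (0.1)-(0.3) p.252] -/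
theorem mLL_eq : ((((Fintype.card (Equiv.Perm (Fin P.d))) ^ 2 * P.L ^ 2 : ℕ) : ℝ) / (Fintype.card (Idx P) : ℝ)) = (P.L : ℝ) ^ 2 / (P.L : ℝ) ^ P.d := by
  rw [BlockAveragingEMLLinearised.card_idx]
  have hL : (0 : ℝ) < P.L := by exact_mod_cast P.L_pos
  have hP : (0 : ℝ) < Fintype.card (Equiv.Perm (Fin P.d)) := by exact_mod_cast Fintype.card_pos
  push_cast
  field_simp

end Counting

/-! ## §2 Geometry: base points block next to `y`; stability of «within 2»; `blockIter` is onto -/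

section Geometry

/-- ★ **THE BASE POINT BLOCKS NEXT TO `y`**: for `s, t < L` and `μ ≠ ν`, `blockOf (x_i + s e_μ + t e_ν)` is one of `y, y+e_μ, y+e_ν, y+e_μ+e_ν` (E ✓), hence within ONE site of `y` in
every coordinate of `T^{(j+1)}`. [cite: Balaban1987RG1, (0.1)-(0.3) p.252] -/
theorem natAbs_rel_blockOf_baseLL_le_one {j : ℕ} (hj : j + 1 ≤ P.m + P.K) (y : Site P (j + 1)) {μ ν : Fin P.d} (hμν : μ ≠ ν)
    (r : Fin P.d → Fin P.L) {s t : ℕ} (hs : s < P.L) (ht : t < P.L) (κ : Fin P.d) :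
    (rel y (blockOf (shiftN (shiftN (Site.blockSite y r) μ s) ν t)) κ).natAbs ≤ 1 := by
  -- the no-wrap conditions hold because every period is at least `2`
  have hper : (2 : ℤ) ≤ (P.sitesPerDir (j + 1) : ℤ) := by
    have h1 : 1 ≤ P.L ^ (P.m + P.K - (j + 1)) := Nat.one_le_pow _ _ P.L_pos
    have : 2 ≤ P.sitesPerDir (j + 1) := by unfold Params.sitesPerDir; omega
    exact_mod_cast this
  have hsh : ∀ τ : Fin P.d, rel y (y.shift τ) = B7Prop1Explicit.e τ := fun τ => by
    have h := rel_shift_of_le y y τ (by rw [rel_self]; simpa using hper)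
    rwa [rel_self, zero_add] at h
  have hμν' : rel y ((y.shift μ).shift ν) = B7Prop1Explicit.e μ + B7Prop1Explicit.e ν := by
    have h0 : (rel y (y.shift μ) ν + 1) * 2 ≤ (P.sitesPerDir (j + 1) : ℤ) := by
      rw [hsh μ, B7Prop1Explicit.e_apply, if_neg (Ne.symm hμν)]; simpa using hper
    rw [rel_shift_of_le y (y.shift μ) ν h0, hsh μ]
  have he : ∀ τ : Fin P.d, (B7Prop1Explicit.e τ κ).natAbs ≤ 1 := fun τ => by
    rw [B7Prop1Explicit.e_apply]; split_ifs <;> simp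
  rcases blockOf_shiftN_shiftN_blockSite hj y r hμν hs.le ht.le with h | h | h | h <;> rw [h]
  · rw [rel_self]; simp
  · rw [hsh μ]; exact he μ
  · rw [hsh ν]; exact he ν
  · rw [hμν', Pi.add_apply, B7Prop1Explicit.e_apply, B7Prop1Explicit.e_apply]
    by_cases h1 : κ = μ
    · subst h1; rw [if_pos rfl, if_neg hμν]; simp
    · rw [if_neg h1, zero_add]; split_ifs <;> simp

/-- ★ **STABILITY OF «WITHIN 2»**: if `w ∈ T^{(r)}` is within `2` of a base point `x_i + s e_μ + t e_ν` of `y ∈ T^{(r+1)}` in every coordinate, then `blockOf w` is within `2` of `y`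
(`|rel y (blockOf w)| ≤ |rel y (blockOf base)| + |rel (blockOf base) (blockOf w)| ≤ 1 + 1`, the second by px10 ✓`natAbs_rel_blockOf_le_one` since `2 ≤ L`). [folklore] -/
theorem natAbs_rel_blockOf_le_two_of_baseLL {r : ℕ} (hr : r + 1 ≤ P.m + P.K) (y : Site P (r + 1)) {μ ν : Fin P.d} (hμν : μ ≠ ν)
    (ri : Fin P.d → Fin P.L) {s t : ℕ} (hs : s < P.L) (ht : t < P.L) (w : Site P r)
    (hw : ∀ κ, (rel (shiftN (shiftN (Site.blockSite y ri) μ s) ν t) w κ).natAbs ≤ 2) (κ : Fin P.d) :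
    (rel y (blockOf w) κ).natAbs ≤ 2 := by
  have hL : 2 ≤ P.L := by have := P.hL.2; omega
  have h1 := natAbs_rel_blockOf_baseLL_le_one hr y hμν ri hs ht κ
  have h2 : (rel (blockOf (shiftN (shiftN (Site.blockSite y ri) μ s) ν t)) (blockOf w) κ).natAbs ≤ 1 :=
    natAbs_rel_blockOf_le_one hr _ w κ ((hw κ).trans hL)
  have h3 := natAbs_rel_le_add y (blockOf (shiftN (shiftN (Site.blockSite y ri) μ s) ν t)) (blockOf w) κ
  omega

/-- ★ `blockIter r : T^{(0)} → T^{(r)}` is onto (standing range): every `r`-block has a finest site (iterate `emb`; lit ✓`Site.blockOf_emb`). [cite: Balaban1987RG1, (0.1) p.251] -/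
theorem exists_blockIter_eq : ∀ (r : ℕ), r ≤ P.m + P.K → ∀ y : Site P r, ∃ x : Site P 0, blockIter r x = y
  | 0, _, y => ⟨y, rfl⟩
  | r + 1, hr, y => by
      obtain ⟨x, hx⟩ := exists_blockIter_eq r (Nat.le_of_succ_le hr) (emb y)
      exact ⟨x, by rw [blockIter_succ, hx, Site.blockOf_emb hr]⟩

end Geometry

/-! ## §3 The composed dilution kernel -/

section Kernel

/-- ★★★ **THE COMPOSED DILUTION KERNEL EXISTS** (orientation `μ ≠ ν`, `r ≤ m + K` levels above the finest): a kernel `K : T^{(r)} × T^{(0)} → ℝ` with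
(K0) `0 ≤ K`; (K1) `K ≤ m^r`; (K2) column sums `≤ m^r`; (K3) row sums `= (L²)^r`; (K4) support: `K y z ≠ 0 ⟹ |rel y (blockIter r z)|_κ ≤ 2` for every `κ`; (K5) DOMINATION WITH
SOURCES of every family obeying the one-step lower-left rows, the sources on the region under `y` propagated by the row sums — `m = (d!)²L²∕|I| = L^{2−d}` (`mLL_eq`).
Construction: `K_0 = δ`, `K_{r+1}(y, z) = |I|⁻¹·Σ_{(i,s,t)} K_r(x_i + s e_μ + t e_ν, z)`; (K1)∕(K2) by §1's two counts, (K4)∕(K5) by §2's stability.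
[cite: Balaban1985Averaging, (19)-(20) p.21, Prop. 1 (51) p.26; Balaban1987RG1, (0.1)-(0.4) pp.251-253] -/
theorem exists_composedKernel {μ ν : Fin P.d} (hμν : μ ≠ ν) : ∀ (r : ℕ), r ≤ P.m + P.K →
    ∃ K : Site P r → Site P 0 → ℝ,
      (∀ y z, 0 ≤ K y z) ∧
      (∀ y z, K y z ≤ ((((Fintype.card (Equiv.Perm (Fin P.d))) ^ 2 * P.L ^ 2 : ℕ) : ℝ) / (Fintype.card (Idx P) : ℝ)) ^ r) ∧
      (∀ z, ∑ y, K y z ≤ ((((Fintype.card (Equiv.Perm (Fin P.d))) ^ 2 * P.L ^ 2 : ℕ) : ℝ) / (Fintype.card (Idx P) : ℝ)) ^ r) ∧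
      (∀ y, ∑ z, K y z = ((P.L : ℝ) ^ 2) ^ r) ∧
      (∀ y z, K y z ≠ 0 → ∀ κ, (rel y (blockIter r z) κ).natAbs ≤ 2) ∧
      (∀ (ρ src : (i : ℕ) → Site P i → ℝ),
        (∀ i, i < r → ∀ y' : Site P (i + 1),
            ρ (i + 1) y' ≤ (Fintype.card (Idx P) : ℝ)⁻¹ *
                ∑ a ∈ (Finset.univ : Finset (Idx P)) ×ˢ (Finset.range P.L ×ˢ Finset.range P.L), ρ i (shiftN (shiftN (Site.blockSite y' a.1.1) μ a.2.1) ν a.2.2) +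
              src (i + 1) y') →
        ∀ (y : Site P r) (σ : ℕ → ℝ),
          (∀ i, 1 ≤ i → i ≤ r → ∀ x : Site P 0, (∀ κ, (rel y (blockIter r x) κ).natAbs ≤ 2) → src i (blockIter i x) ≤ σ i) →
          ρ r y ≤ ∑ z, K y z * ρ 0 z + ∑ i ∈ Finset.Icc 1 r, ((P.L : ℝ) ^ 2) ^ (r - i) * σ i)
  | 0, _ => by
      classical
      refine ⟨fun y z => if y = z then 1 else 0, ?_, ?_, ?_, ?_, ?_, ?_⟩
      · intro y z; dsimp only; split_ifs <;> norm_num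
      · intro y z; dsimp only; rw [pow_zero]; split_ifs <;> norm_num
      · intro z; dsimp only; rw [pow_zero, Finset.sum_ite_eq', if_pos (Finset.mem_univ _)]
      · intro y; dsimp only; rw [pow_zero, Finset.sum_ite_eq, if_pos (Finset.mem_univ _)]
      · intro y z h κ
        have hyz : y = z := by by_contra hne; exact h (if_neg hne)
        subst hyz; rw [blockIter_zero, rel_self]; simp
      · intro ρ src _ y σ _
        have h1 : ∑ z, (if y = z then (1 : ℝ) else 0) * ρ 0 z = ρ 0 y := by
          simp only [ite_mul, one_mul, zero_mul, Finset.sum_ite_eq, Finset.mem_univ, if_true]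
        rw [h1, Finset.Icc_eq_empty_of_lt Nat.zero_lt_one, Finset.sum_empty, add_zero]
  | r + 1, hr => by
      classical
      obtain ⟨K, h0, h1, h2, h3, h4, h5⟩ := exists_composedKernel hμν r (Nat.le_of_succ_le hr)
      -- abbreviations
      set A : Finset (Idx P × (ℕ × ℕ)) := (Finset.univ : Finset (Idx P)) ×ˢ (Finset.range P.L ×ˢ Finset.range P.L) with hA
      set cI : ℝ := (Fintype.card (Idx P) : ℝ) with hcI
      set C : ℝ := ((((Fintype.card (Equiv.Perm (Fin P.d))) ^ 2 * P.L ^ 2 : ℕ) : ℝ)) with hC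
      set mP : ℝ := C / cI with hmP
      have hcIpos : 0 < cI := by rw [hcI]; exact_mod_cast Fintype.card_pos
      have hC0 : 0 ≤ C := by rw [hC]; exact Nat.cast_nonneg _
      have hmPC : mP = cI⁻¹ * C := by rw [hmP, div_eq_inv_mul]
      have hmP0 : 0 ≤ mP := by rw [hmP]; exact div_nonneg hC0 hcIpos.le
      have hmem : ∀ a ∈ A, a.2.1 < P.L ∧ a.2.2 < P.L := fun a ha => by
        rw [hA, Finset.mem_product, Finset.mem_product, Finset.mem_range, Finset.mem_range] at ha; exact ha.2
      have hcardA : (A.card : ℝ) = cI * (P.L : ℝ) ^ 2 := by rw [hA, card_triples, hcI]; push_cast; ring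
      refine ⟨fun y z => cI⁻¹ * ∑ a ∈ A, K (shiftN (shiftN (Site.blockSite y a.1.1) μ a.2.1) ν a.2.2) z, ?_, ?_, ?_, ?_, ?_, ?_⟩
      · -- (K0)
        intro y z
        exact mul_nonneg (inv_nonneg.mpr hcIpos.le) (Finset.sum_nonneg fun a _ => h0 _ _)
      · -- (K1): fiberwise count (one coarse plaquette) × column sum of `K`
        intro y z
        have hfib := sum_baseLL_le hr y μ ν (fun y' => K y' z) (fun y' => h0 y' z)
        calc cI⁻¹ * ∑ a ∈ A, K (shiftN (shiftN (Site.blockSite y a.1.1) μ a.2.1) ν a.2.2) z ≤ cI⁻¹ * (C * ∑ y', K y' z) :=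
              mul_le_mul_of_nonneg_left hfib (inv_nonneg.mpr hcIpos.le)
          _ = mP * ∑ y', K y' z := by rw [hmPC]; ring
          _ ≤ mP * mP ^ r := mul_le_mul_of_nonneg_left (h2 z) hmP0
          _ = mP ^ (r + 1) := by ring
      · -- (K2): joint count (all coarse plaquettes) × column sum of `K`
        intro z
        have hjoint := sum_sum_baseLL_le hr μ ν (fun y' => K y' z) (fun y' => h0 y' z)
        calc ∑ y, cI⁻¹ * ∑ a ∈ A, K (shiftN (shiftN (Site.blockSite y a.1.1) μ a.2.1) ν a.2.2) z
            = cI⁻¹ * ∑ y, ∑ a ∈ A, K (shiftN (shiftN (Site.blockSite y a.1.1) μ a.2.1) ν a.2.2) z := by rw [Finset.mul_sum]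
          _ ≤ cI⁻¹ * (C * ∑ y', K y' z) := mul_le_mul_of_nonneg_left hjoint (inv_nonneg.mpr hcIpos.le)
          _ = mP * ∑ y', K y' z := by rw [hmPC]; ring
          _ ≤ mP * mP ^ r := mul_le_mul_of_nonneg_left (h2 z) hmP0
          _ = mP ^ (r + 1) := by ring
      · -- (K3): row sums
        intro y
        rw [← Finset.mul_sum, Finset.sum_comm]
        calc cI⁻¹ * ∑ a ∈ A, ∑ z, K (shiftN (shiftN (Site.blockSite y a.1.1) μ a.2.1) ν a.2.2) z
            = cI⁻¹ * ∑ a ∈ A, ((P.L : ℝ) ^ 2) ^ r := by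
              congr 1; exact Finset.sum_congr rfl fun a _ => h3 _
          _ = cI⁻¹ * (A.card * ((P.L : ℝ) ^ 2) ^ r) := by rw [Finset.sum_const, nsmul_eq_mul]
          _ = ((P.L : ℝ) ^ 2) ^ (r + 1) := by
              rw [hcardA]; field_simp; ring
      · -- (K4): support
        intro y z h κ
        replace h : cI⁻¹ * ∑ a ∈ A, K (shiftN (shiftN (Site.blockSite y a.1.1) μ a.2.1) ν a.2.2) z ≠ 0 := h
        have hne : ∑ a ∈ A, K (shiftN (shiftN (Site.blockSite y a.1.1) μ a.2.1) ν a.2.2) z ≠ 0 := by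
          intro h0'; exact h (by rw [h0', mul_zero])
        obtain ⟨a, ha, hKa⟩ := Finset.exists_ne_zero_of_sum_ne_zero hne
        have hst := hmem a ha
        have hw := h4 _ z hKa
        rw [blockIter_succ]
        exact natAbs_rel_blockOf_le_two_of_baseLL hr y hμν a.1.1 hst.1 hst.2 (blockIter r z) hw κ
      · -- (K5): domination with sources
        intro ρ src hrow y σ hσ
        -- the inductive domination at every base point of `y`
        have hIH : ∀ a ∈ A, ρ r (shiftN (shiftN (Site.blockSite y a.1.1) μ a.2.1) ν a.2.2) ≤
            ∑ z, K (shiftN (shiftN (Site.blockSite y a.1.1) μ a.2.1) ν a.2.2) z * ρ 0 z + ∑ i ∈ Finset.Icc 1 r, ((P.L : ℝ) ^ 2) ^ (r - i) * σ i := by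
          intro a ha
          have hst := hmem a ha
          refine h5 ρ src (fun i hi y' => hrow i (by omega) y') _ σ fun i hi1 hir x hx => hσ i hi1 (by omega) x fun κ => ?_
          rw [blockIter_succ]
          exact natAbs_rel_blockOf_le_two_of_baseLL hr y hμν a.1.1 hst.1 hst.2 (blockIter r x) hx κ
        -- the top source
        have htop : src (r + 1) y ≤ σ (r + 1) := by
          obtain ⟨x, hx⟩ := exists_blockIter_eq (r + 1) hr y
          have := hσ (r + 1) (by omega) le_rfl x (fun κ => by rw [hx, rel_self]; simp)
          rwa [hx] at this
        -- average the inductive bounds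
        have havg : cI⁻¹ * ∑ a ∈ A, ρ r (shiftN (shiftN (Site.blockSite y a.1.1) μ a.2.1) ν a.2.2) ≤
            ∑ z, (cI⁻¹ * ∑ a ∈ A, K (shiftN (shiftN (Site.blockSite y a.1.1) μ a.2.1) ν a.2.2) z) * ρ 0 z +
              (P.L : ℝ) ^ 2 * ∑ i ∈ Finset.Icc 1 r, ((P.L : ℝ) ^ 2) ^ (r - i) * σ i := by
          have step1 : cI⁻¹ * ∑ a ∈ A, ρ r (shiftN (shiftN (Site.blockSite y a.1.1) μ a.2.1) ν a.2.2) ≤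
              cI⁻¹ * ∑ a ∈ A, (∑ z, K (shiftN (shiftN (Site.blockSite y a.1.1) μ a.2.1) ν a.2.2) z * ρ 0 z +
                ∑ i ∈ Finset.Icc 1 r, ((P.L : ℝ) ^ 2) ^ (r - i) * σ i) :=
            mul_le_mul_of_nonneg_left (Finset.sum_le_sum hIH) (inv_nonneg.mpr hcIpos.le)
          have step2 : cI⁻¹ * ∑ a ∈ A, (∑ z, K (shiftN (shiftN (Site.blockSite y a.1.1) μ a.2.1) ν a.2.2) z * ρ 0 z +
                ∑ i ∈ Finset.Icc 1 r, ((P.L : ℝ) ^ 2) ^ (r - i) * σ i) =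
              ∑ z, (cI⁻¹ * ∑ a ∈ A, K (shiftN (shiftN (Site.blockSite y a.1.1) μ a.2.1) ν a.2.2) z) * ρ 0 z +
                (P.L : ℝ) ^ 2 * ∑ i ∈ Finset.Icc 1 r, ((P.L : ℝ) ^ 2) ^ (r - i) * σ i := by
            rw [Finset.sum_add_distrib, Finset.sum_const, nsmul_eq_mul, mul_add, hcardA]
            congr 1
            · rw [Finset.sum_comm, Finset.mul_sum]
              refine Finset.sum_congr rfl fun z _ => ?_
              rw [← Finset.sum_mul, mul_assoc]
            · field_simp
          exact step1.trans step2.le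
        -- assemble with the row at level `r + 1`
        have hrow' := hrow r (Nat.lt_succ_self r) y
        have hsrc : (P.L : ℝ) ^ 2 * ∑ i ∈ Finset.Icc 1 r, ((P.L : ℝ) ^ 2) ^ (r - i) * σ i + σ (r + 1) =
            ∑ i ∈ Finset.Icc 1 (r + 1), ((P.L : ℝ) ^ 2) ^ (r + 1 - i) * σ i := by
          rw [Finset.sum_Icc_succ_top (by omega : 1 ≤ r + 1), Nat.sub_self, pow_zero, one_mul, Finset.mul_sum]
          congr 1
          refine Finset.sum_congr rfl fun i hi => ?_
          rw [Finset.mem_Icc] at hi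
          rw [show r + 1 - i = (r - i) + 1 by omega, pow_succ]
          ring
        calc ρ (r + 1) y ≤ cI⁻¹ * ∑ a ∈ A, ρ r (shiftN (shiftN (Site.blockSite y a.1.1) μ a.2.1) ν a.2.2) + src (r + 1) y := hrow'
          _ ≤ (∑ z, (cI⁻¹ * ∑ a ∈ A, K (shiftN (shiftN (Site.blockSite y a.1.1) μ a.2.1) ν a.2.2) z) * ρ 0 z +
                (P.L : ℝ) ^ 2 * ∑ i ∈ Finset.Icc 1 r, ((P.L : ℝ) ^ 2) ^ (r - i) * σ i) + σ (r + 1) := add_le_add havg htop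
          _ = _ := by rw [add_assoc, hsrc]

end Kernel

end Summit.QuantumFields.YangMills.Theorems.FluctuationComparisonRegPrIntLS2BetaComposedDilutionKernel

end
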